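import Summits.QuantumAdvantage.QuantumAdvantage.Theorems.CubicForrelationSignedExactCubicForrelationNotPrBPPStubPlumbing

/-!
# Stub `stub_plumbingCoins` of line `dual-pingpong-frame` (crux stmt-QuantumAdvantage-13932): the coin plumbing

Support file (`--supports stmt-QuantumAdvantage-13932`) for the refutation skeleton of crux
`Summit.QuantumAdvantage.QuantumAdvantage.Theses.CubicForrelation.SignedExactCubicForrelationNotPrBPP`
(route `QuantumAdvantage/CubicForrelation`, line `dual-pingpong-frame`, GROW reshape). It proves the registered
stub `stub_plumbingCoins : PairFinderExactCoins → SignReadout → signedExactCubicForrelationProblem 2 ∈ PromiseBPP'`,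
the re-cut of the landed deterministic plumbing `stub_plumbing`
(`CubicForrelationSignedExactCubicForrelationNotPrBPPStubPlumbing.lean`) for a RANDOMISED finder: the finder
`find ∈ FP` now reads the whole pair `⟨x, y⟩` (instance code and coins) and comes with a coin polynomial `p`;
on every exact cubic pair (`k = 2`, `n` even, `B₂`-circuits of degree `≤ 3`, `Φ = ±1`) it is SOUND on every
coin string (`find ⟨x, y⟩ = encList L` with `L ≠ []` forces the `𝔽₂`-row span `V(L)` of `L` to be an
M-subspace of `g = C₁`: `0 ∈ V`, `⊕`-closed, `|V|² = 2ⁿ`, all second derivatives of `g` along `V` vanish) and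
COMPLETE with probability `≥ 2/3` (`Pr_{y ∈ {0,1}^{p |x|}}[∃ L ≠ [], find ⟨x, y⟩ = encList L] ≥ 2/3`).

**The machine** (no new definition is needed). On `⟨x, y⟩` with `x = encode (n, k, C₀, C₁)`: rows
`L := decNil (find ⟨x, y⟩)`; REJECT if `L = []`; otherwise the landed deterministic machine `Plumbing.accept`
run with the curried finder `x' ↦ find ⟨x', y⟩` — i.e. the landed core decision `Plumbing.acceptCore` on `L`
(reduced echelon form of `L` over `𝔽₂`, kernel vectors `x_c`, slope vector `μ` with `μ_c = f(x_c) ⊕ f(0)` at the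
free columns, ACCEPT iff `f(0) = g(μ)`) at the effective dimension `min n (|x| + 1)` (`= n` on the promise,
`Plumbing.n_le_of_value`). As a Boolean:
`acc ⟨x, y⟩ = !(decNil (find ⟨x, y⟩)).isEmpty && Plumbing.accept (x' ↦ find ⟨x', y⟩) t x`. It is polynomial
time on genuine instance codes (`acceptI_codeFP`: the landed `CodeFP` assembly with the finder fed the pair code,
`pairE encode strE = boolPair`), and the resulting `FP` string function is normalised to a one-bit `FP` decider
by `z ↦ [F z = [true]]` (`oneBit_normalise`) exactly as in the landed file.

**Correctness.** When `find ⟨x, y⟩ = encList L` with `L ≠ []`, the guard passes and the landed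
`Plumbing.accept_eq_true_iff` for the curried finder (M-subspace soundness clause + `SignReadout` + McFarland
duality `dual_affine_on_perp_cosets` + slope transfer `slope_muOf`) gives `acc = true ↔ Φ = 1` on that coin
string (`accept_eq_true_iff`). Hence on a YES instance (`Φ = 1`) the acceptance event contains the completeness
event and has probability `≥ 2/3`, and on a NO instance (`Φ = -1`) the REJECTION event contains the completeness
event (on it the answer is `[Φ = 1] = false`) and has probability `≥ 2/3` as well (`uniformProb_mono` both
times; nothing is claimed about coin strings on which the finder's output is not a non-empty list code, so both
bounds use the completeness clause). `PromiseProblem.mem_PromiseBPP'_of_fp_decider` with the finder's polynomial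
`p` concludes.

## References

* [Goldreich2006] O. Goldreich, *On promise problems: a survey*, LNCS 3895 (2006), Def. 1.2 (promise-BPP).
* [AaronsonAmbainis2018] S. Aaronson, A. Ambainis, *Forrelation*, SIAM J. Comput. 47 (2018), §1.1.1, §3.2, §6.
* [Carlet2020] C. Carlet, *Boolean Functions for Cryptography and Coding Theory*, CUP 2021, Prop. 77.
* [AroraBarak2009] S. Arora, B. Barak, *Computational Complexity*, CUP 2009, §1.3 (polynomial time), Def. 7.3.
-/

noncomputable section

set_option linter.dupNamespace false -- D-0017: single-problem summit ⇒ `QuantumAdvantage.QuantumAdvantage` by design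

namespace Summit.QuantumAdvantage.QuantumAdvantage.Theorems.SignedExactCubicForrelationNotPrBPP

open Finset
open Literature.Computability.Complexity Literature.Computability.QuantumComplexity
open Literature.Computability.QuantumComplexity.BuzetChailloux (bxor zeroVec)

namespace PlumbingCoins

open _root_.Computability Literature.Computability.Complexity.CodeFP Literature.Computability.Complexity.Brick
open ForrCode CubicDequant Plumbing

/-! ### Polynomial time -/

/-- **The decision on genuine instance codes** `⟨encode I, y⟩ ↦ [decNil (find ⟨encode I, y⟩) ≠ []] ∧
Plumbing.accept (x' ↦ find ⟨x', y⟩) (instOf I) (encode I)` is computed in polynomial time, for `find ∈ FP` (the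
landed `CodeFP` assembly of `Plumbing.acceptI_codeFP`, the finder being fed the pair code itself).
[cite: AroraBarak2009, §1.3] -/
theorem acceptI_codeFP {find : List Bool → List Bool} (hfind : find ∈ FP) :
    CodeFP (pairE KForrelationInstance.encode strE) bitE (fun q => !(decNil (find (boolPair q.1.encode q.2))).isEmpty &&
      Plumbing.accept (fun x => find (boolPair x q.2)) (instOf q.1) q.1.encode) := by
  -- adapted from `Plumbing.acceptI_codeFP`
  have hI : CodeFP (pairE KForrelationInstance.encode strE) KForrelationInstance.encode (fun p => p.1) := fst _ _
  have hx : CodeFP (pairE KForrelationInstance.encode strE) strE (fun p => p.1.encode) :=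
    (transparent (eα := KForrelationInstance.encode) (eβ := strE) (g := fun I => I.encode) fun _ => rfl).comp hI
  have ht : CodeFP (pairE KForrelationInstance.encode strE) instE (fun p => instOf p.1) := instOf_codeFP.comp hI
  have hL1 : CodeFP (pairE KForrelationInstance.encode strE) unE (fun p => p.1.encode.length + 1) :=
    unSucc.comp (strLength.comp hx)
  have hne : CodeFP (pairE KForrelationInstance.encode strE) unE (fun p => nEff (instOf p.1) p.1.encode.length) :=
    (unOfNatMin.comp (hL1.pair (instN_codeFP.comp ht))).congr fun _ => rfl
  have hc : ∀ i : ℕ, CodeFP (pairE KForrelationInstance.encode strE) pcE (fun p => circAt (instOf p.1) i) := fun i =>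
    circAt_codeFP.comp (ht.pair (const _ i))
  have hz : CodeFP (pairE KForrelationInstance.encode strE) strE (fun p => find (boolPair p.1.encode p.2)) :=
    of_fn (eα := pairE KForrelationInstance.encode strE) (eβ := strE) (g := fun p => find (boolPair p.1.encode p.2))
      find hfind fun _ => rfl
  have hrows : CodeFP (pairE KForrelationInstance.encode strE) (rawE strE) (fun p => decNil (find (boolPair p.1.encode p.2))) :=
    SumcheckMA.decNilC.comp hz
  have hemp : CodeFP (pairE KForrelationInstance.encode strE) bitE
      (fun p => !(decNil (find (boolPair p.1.encode p.2))).isEmpty) := ((rawIsEmpty strE).comp hrows).not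
  exact (hemp.and (acceptCore_codeFP.comp ((hne.pair ((hc 0).pair (hc 1))).pair hrows))).congr fun _ => rfl

/-- **One-bit normalisation** of an `FP` string function `F`: `z ↦ [F z = [true]]` is in `FP`, is one-bit on every
string, and agrees with `F` wherever `F` is already one-bit. [cite: Goldreich2006, Def. 1.2] -/
theorem oneBit_normalise {F : List Bool → List Bool} (hF : F ∈ FP) :
    (eqPairFn ∘ fanoutFn F fun _ => [true]) ∈ FP ∧ OneBit (eqPairFn ∘ fanoutFn F fun _ => [true]) ∧
      ∀ (z : List Bool) (b : Bool), F z = [b] → (eqPairFn ∘ fanoutFn F fun _ => [true]) z = [b] := by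
  -- adapted from `Plumbing.dec_spec`
  refine ⟨comp_mem_FP eqPairFn_mem_FP (fanoutFn_mem_FP hF (const_mem_FP _)), OneBit.comp oneBit_eqPairFn _, fun z b hz => ?_⟩
  rw [Function.comp_apply, fanoutFn_apply, eqPairFn_boolPair, hz]
  cases b <;> rfl

/-! ### Correctness on the promise -/

variable (I : KForrelationInstance) (hk : I.k = 2)

include hk in
/-- **Correctness of the decision on the promise, per coin string.** If on the coins `y` the finder returns the
code of a non-empty `L` whose row span `V(L)` is an M-subspace of `g`, then, given the sign readout and
`Φ = ±1`, the machine accepts iff `Φ = 1`: the guard passes (`decNil (encList L) = L ≠ []`) and the landed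
`Plumbing.accept_eq_true_iff` (McFarland duality `dual_affine_on_perp_cosets`, slope transfer `slope_muOf`, readout
`Φ = (-1)^{f 0}(-1)^{g μ}`) applies to the curried finder `x' ↦ find ⟨x', y⟩`.
[cite: Carlet2020, Prop. 77] [cite: AaronsonAmbainis2018, §1.1.1] -/
theorem accept_eq_true_iff {find : List Bool → List Bool} {L : List (List Bool)} {y : List Bool}
    (hL : find (boolPair I.encode y) = encList L) (hL0 : L ≠ [])
    (hV : (zeroVec ∈ VL I.n L ∧ ∀ x ∈ VL I.n L, ∀ y ∈ VL I.n L, bxor x y ∈ VL I.n L) ∧ (((VL I.n L).card : ℝ) ^ 2 = (2 : ℝ) ^ I.n) ∧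
      (∀ u ∈ VL I.n L, ∀ v ∈ VL I.n L, ∀ x, (gI I hk x ^^ gI I hk (bxor x u) ^^ gI I hk (bxor x v) ^^ gI I hk (bxor x (bxor u v))) = false))
    (hread : ∀ (n : ℕ) (a b : (Fin n → Bool) → Bool) (V : Finset (Fin n → Bool)) (μ : Fin n → Bool),
      (forrelation a b = 1 ∨ forrelation a b = -1) →
      ((zeroVec ∈ V ∧ ∀ x ∈ V, ∀ y ∈ V, bxor x y ∈ V) ∧ (((V).card : ℝ) ^ 2 = (2 : ℝ) ^ (n)) ∧
        (∀ u ∈ V, ∀ v ∈ V, ∀ x, (b x ^^ b (bxor x u) ^^ b (bxor x v) ^^ b (bxor x (bxor u v))) = false)) →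
      (∀ x ∈ (Finset.univ.filter fun y => ∀ v ∈ V, twist v y = 1), signOf (a x) * twist x μ = signOf (a zeroVec)) →
      forrelation a b = signOf (a zeroVec) * signOf (b μ))
    (hv : I.value = 1 ∨ I.value = -1) :
    (!(decNil (find (boolPair I.encode y))).isEmpty && Plumbing.accept (fun x => find (boolPair x y)) (instOf I) I.encode) = true ↔
      I.value = 1 := by
  obtain ⟨a, l, rfl⟩ := List.exists_cons_of_ne_nil hL0
  rw [hL, decNil_encList, List.isEmpty_cons, Bool.not_false, Bool.true_and]
  exact Plumbing.accept_eq_true_iff I hk (find := fun x => find (boolPair x y)) hL hV hread hv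

end PlumbingCoins

open PlumbingCoins in
/-- **Stub `stub_plumbingCoins`** (line `dual-pingpong-frame`, crux `SignedExactCubicForrelationNotPrBPP`): a
polynomial-time COIN finder which, on every exact cubic pair, is sound on every coin string (a returned non-empty
`L` spans an M-subspace of `g`) and returns a non-empty list code with probability `≥ 2/3` (first hypothesis,
`PairFinderExactCoins`), together with the sign readout (second hypothesis, `SignReadout`), puts the signed exact
slice of cubic `2`-fold Forrelation into `PromiseBPP'`. THE MACHINE on `⟨x, y⟩`: rows `L := decNil (find ⟨x, y⟩)`,
reject if `L = []`, else the landed deterministic machine `Plumbing.accept` with the curried finder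
`x' ↦ find ⟨x', y⟩` (Gaussian elimination over `𝔽₂`, slope vector `μ` of `f` on `V(L)^⊥`, accept iff
`f(0) = g(μ)`); it is `FP` on instance codes (`acceptI_codeFP`) and normalised to a one-bit `FP` decider
(`oneBit_normalise`). CORRECTNESS: on a coin string where the finder returns a non-empty list code the answer is
`[Φ = 1]` (`accept_eq_true_iff`, from the landed `Plumbing.accept_eq_true_iff`), so the acceptance event on YES
instances and the rejection event on NO instances both contain the completeness event, of probability `≥ 2/3`
(`uniformProb_mono`); `PromiseProblem.mem_PromiseBPP'_of_fp_decider` with the finder's coin polynomial concludes.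
[cite: Goldreich2006, Def. 1.2] [cite: AaronsonAmbainis2018, §1.1.1] [cite: Carlet2020, Prop. 77] -/
theorem stub_plumbingCoins :
    (∃ find ∈ FP, ∃ p : Polynomial ℕ, ∀ (I : KForrelationInstance) (hk : I.k = 2), Even I.n → I.IsOverB2 →
        (∀ i, IsDegLeFun 3 (I.C i).eval) → (I.value = 1 ∨ I.value = -1) →
        (∀ (y : List Bool) (L : List (List Bool)), find (boolPair I.encode y) = encList L → L ≠ [] →
          ((zeroVec ∈ (@Finset.filter (Fin (I.n) → Bool) (fun v => (fun i => if v i then (1 : ZMod 2) else 0) ∈ F2Elim.rowSpan (I.n) L) (Classical.decPred _) Finset.univ) ∧ ∀ x ∈ (@Finset.filter (Fin (I.n) → Bool) (fun v => (fun i => if v i then (1 : ZMod 2) else 0) ∈ F2Elim.rowSpan (I.n) L) (Classical.decPred _) Finset.univ), ∀ y ∈ (@Finset.filter (Fin (I.n) → Bool) (fun v => (fun i => if v i then (1 : ZMod 2) else 0) ∈ F2Elim.rowSpan (I.n) L) (Classical.decPred _) Finset.univ), bxor x y ∈ (@Finset.filter (Fin (I.n) → Bool) (fun v => (fun i => if v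 i then (1 : ZMod 2) else 0) ∈ F2Elim.rowSpan (I.n) L) (Classical.decPred _) Finset.univ)) ∧ ((((@Finset.filter (Fin (I.n) → Bool) (fun v => (fun i => if v i then (1 : ZMod 2) else 0) ∈ F2Elim.rowSpan (I.n) L) (Classical.decPred _) Finset.univ)).card : ℝ) ^ 2 = (2 : ℝ) ^ (I.n)) ∧ ∀ u ∈ (@Finset.filter (Fin (I.n) → Bool) (fun v => (fun i => if v i then (1 : ZMod 2) else 0) ∈ F2Elim.rowSpan (I.n) L) (Classical.decPred _) Finset.univ), ∀ v ∈ (@Finset.filter (Fin (I.n) → Bool) (fun v => (fun i => if v i then (1 : ZMod 2) else 0) ∈ F2Elim.rowSpan (I.n) L) (Classical.decPred _) Finset.univ), ∀ x, ((I.C (Fin.cast hk.symm 1)).eval x ^^ (I.C (Fin.cast hk.symm 1)).eval (bxor x u) ^^ (I.C (Fin.cast hk.symm 1)).eval (bxor x v) ^^ (I.C (Fin.cast hk.symm 1)).eval (bxor x (bxor u v))) = false)) ∧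
        (2 / 3 : ℝ) ≤ uniformProb (p.eval I.encode.length)
            {y | ∃ L : List (List Bool), L ≠ [] ∧ find (boolPair I.encode y) = encList L}) →
    (∀ (n : ℕ) (a b : (Fin n → Bool) → Bool) (V : Finset (Fin n → Bool)) (μ : Fin n → Bool),
    (forrelation a b = 1 ∨ forrelation a b = -1) →
    ((zeroVec ∈ V ∧ ∀ x ∈ V, ∀ y ∈ V, bxor x y ∈ V) ∧ (((V).card : ℝ) ^ 2 = (2 : ℝ) ^ (n)) ∧ (∀ u ∈ V, ∀ v ∈ V, ∀ x, (b x ^^ b (bxor x u) ^^ b (bxor x v) ^^ b (bxor x (bxor u v))) = false)) →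
    (∀ x ∈ (Finset.univ.filter fun y => ∀ v ∈ V, twist v y = 1), signOf (a x) * twist x μ = signOf (a zeroVec)) →
    forrelation a b = signOf (a zeroVec) * signOf (b μ)) →
    signedExactCubicForrelationProblem 2 ∈ PromiseBPP' := by
  rintro ⟨find, hfind, p, hfinder⟩ hread
  obtain ⟨F, hF, hFI⟩ := acceptI_codeFP hfind
  obtain ⟨hdecFP, hdec1, hdecv⟩ := oneBit_normalise hF
  refine (signedExactCubicForrelationProblem 2).mem_PromiseBPP'_of_fp_decider hdecFP hdec1 p ?_ ?_
  · -- YES (`Φ = 1`): the acceptance event contains the completeness event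
    rintro x ⟨I, ⟨hB2, hval, hk, heven, hdeg⟩, rfl⟩
    obtain ⟨hsound, hcomp⟩ := hfinder I hk heven hB2 hdeg (Or.inl hval)
    refine hcomp.trans (PromiseCook.uniformProb_mono ?_)
    rintro y ⟨L, hL0, hL⟩
    have hacc := (accept_eq_true_iff I hk hL hL0 (hsound y L hL hL0) hread (Or.inl hval)).2 hval
    exact hdecv _ true ((hFI (I, y)).trans (congrArg CodeFP.bitE hacc))
  · -- NO (`Φ = -1`): the rejection event contains the completeness event
    rintro x ⟨I, ⟨hB2, hval, hk, heven, hdeg⟩, rfl⟩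
    obtain ⟨hsound, hcomp⟩ := hfinder I hk heven hB2 hdeg (Or.inr hval)
    refine hcomp.trans (PromiseCook.uniformProb_mono ?_)
    rintro y ⟨L, hL0, hL⟩
    have h := accept_eq_true_iff I hk hL hL0 (hsound y L hL hL0) hread (Or.inr hval)
    have hacc := eq_false_of_ne_true fun hacc => absurd (h.1 hacc) (by rw [hval]; norm_num)
    exact hdecv _ false ((hFI (I, y)).trans (congrArg CodeFP.bitE hacc))

end Summit.QuantumAdvantage.QuantumAdvantage.Theorems.SignedExactCubicForrelationNotPrBPP

end
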